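import Mathlib.Combinatorics.SimpleGraph.Metric
import Literature.MathematicalPhysics.QuantumFieldTheory.LatticeLangevinDynamics
import Literature.MathematicalPhysics.QuantumFieldTheory.THooftRegimeThresholds
import Literature.MathematicalPhysics.QuantumLattice.RepLieAlgebraUnitary
import Literature.MathematicalPhysics.QuantumFieldTheory.Balaban1983to89.TraceWordsSeparateOrbitsOrthogonal
import Literature.Geometry.Riemannian.MetricFlowConcentration
import HarnessLib

/-!
# Shen–Zhu–Zhu's ergodicity statements for the lattice Yang–Mills Langevin dynamics with their
# explicit rates `K_𝒮` (Theorem 4.2, Remark 4.6) and `K̃_𝒮 = C_{Ric,N} - (4+4√a)N|β|(d-1)`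
# (Lemma 5.1, (5.15)), for `SO(N)` and `SU(N)` (CMP 400 (2023) 805–851 = arXiv:2204.12737, §4.1, §5)

Numbers are those of arXiv:2204.12737v1 (checked against the LaTeX source). The dynamics is the
tree's `latticeLangevinDynamics r β'` (`LatticeLangevinDynamics`: SZZ's SDE (3.3)–(3.4) on the torus
`Λ_L` for `ρ(G) = SO(N)` or `SU(N)` — `LatticeRep.IsClassicalDefining`, split here into its two cases
`IsDefiningSO` / `IsDefiningSU` since the constants differ; SZZ's `Nβ` is the tree coupling `β'`),
with its solutions `LinkSDE.IsSolution` and transition operators `markovTransition`.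

Constants (hypothesis-free reals): `C_{Ric,N} = α(N+2)/4 - 1`, `α = 1` (`SO(N)`), `2` (`SU(N)`)
((4.8); `szzRicciConstSO/SU`); `K_𝒮 = C_{Ric,N} - 8N|β|(d-1)` (Assumption 1.1; the tree's
`szzBakryEmeryConstSO/SU`); the ERGODIC RATE (5.15) `K̃_𝒮 = C_{Ric,N} - (4+4√a)N|β|(d-1)`, `a > 1`
(`szzErgodicRateSO/SU`). Proved: `K̃_𝒮(1) = K_𝒮`, `K̃_𝒮 ≤ K_𝒮` (`a ≥ 1`), and SZZ's "by the condition
`K_𝒮 > 0` there exists `a > 1` such that (5.15)" (`exists_szzErgodicRateSU_pos`, `…SO_pos`).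

Distances (definitions): `ρ` = Riemannian distance of the bi-invariant Hilbert–Schmidt metric (2.3)
(`LatticeRep.riemannDist`: geodesics through `Q` are `t ↦ e^{tX}Q`, `X ∈ 𝔤`, so
`ρ(Q,Q') = inf{|X| : e^X Q = Q'}` — Gallot–Hulin–Lafontaine 2.90, 2.103, 2.108 (c));
`ρ_L² = Σ_{e∈E⁺_{Λ_L}} ρ(Q_e,Q'_e)²` (§4.1; `torusRiemannDistSq`); `ρ_{∞,a}² = Σ_{e∈E⁺} a^{-|e|} ρ(Q_e,Q'_e)²`
((1.4); `weightedRiemannDistSq`, `|e|` = graph distance of `e` to `0`, (3.6), `edgeLevel`) on periodic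
extensions (`torusLift`); `W_2^ρ(μ,ν)² = inf_{π∈𝒞(μ,ν)} π(ρ²)` (§1.2; `szzWassersteinSq`, couplings =
`Literature.Geometry.Riemannian.IsCoupling`).

Named facts (`def … : Prop`, not proved here), each a conjunction `SU(N)`-case ∧ `SO(N)`-case:
* **Theorem 4.2 (1) + "in particular"** (`shenZhuZhu_finiteVolumeErgodicity`): under Assumption 1.1,
  (4.5) `W_2^{ρ_L}(δ_Q P_t^L, δ_{Q̄} P_t^L) ≤ e^{-K_𝒮 t} ρ_L(Q,Q̄)`, and the invariant measure of
  `(P_t^L)` is unique (shapes `SZZDiracContraction`, `SZZUniqueInvariantMeasure`).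
* **Remark 4.6** (`shenZhuZhu_L2SpectralGap`): `‖P_t^L f - μ_{Λ_L,N,β}(f)‖_{L²} ≤ e^{-tK_𝒮}‖f‖_{L²}`.
* **Lemma 5.1** (`shenZhuZhu_weightedContraction`): for every `a > 1` with `K̃_𝒮 > 0` and EVERY `L`,
  `W_2^{ρ_{∞,a}}(μP_t^L, νP_t^L) ≤ e^{-K̃_𝒮 t} W_2^{ρ_{∞,a}}(μ,ν)`, in the Dirac form `μ = δ_Q`, `ν = δ_{Q̄}`
  (the pointwise coupling estimate (5.3) that the printed proof establishes and integrates).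
Theorem 1.2 (2) (uniqueness of the infinite-volume limit) is typed in the sibling `ShenZhuZhuOrthogonal`.

**Flags (faithfulness).** (a) Theorem 4.2 (2) = (4.6) (`W_p`, `1 < p < 2`) and Lemma 5.1 for general
`μ, ν ∈ 𝒫(𝒬_L)` are NOT typed, only Dirac initial data (random initial data need an independent initial
σ-algebra, absent from `LatticeLangevinDynamics`); the printed statements imply the Dirac forms
(`W_2(δ_Q,δ_{Q̄}) = ρ(Q,Q̄)`). (b) `P_t^L` acts through ANY strong solution from `Q` adapted to the
natural filtration of its driving Brownian motion; by SZZ Lemma 3.2 (tree: `LatticeLangevinWellPosed`)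
all have the same law. (c) Theorem 1.2 (1), (3) (invariant measure and `W_2^{ρ_{∞,a}}`-ergodicity (1.7)
of the INFINITE-volume semigroup of (1.6) on `G^{E⁺(ℤ^d)}`), Theorem 3.5, Propositions 3.4/3.6 are not
typed: the tree has no carrier for the infinite-volume SDE — TODO(general form); their quantitative
content, the rate `K̃_𝒮` uniform in `L`, is Lemma 5.1. (d) `|e|` ("the minimum of the distances from
the two vertices of `e` to `0`", (3.6)) is read as GRAPH distance in `ℤ^d` (the proof of Lemma 5.1
uses `|ē| = |e| + 1` for neighbouring links). (e) `L > 1` (Cor. 4.4). (f) Remark 4.6 is typed for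
bounded measurable `f` (dense in `L²`).

## References

* H. Shen, R. Zhu, X. Zhu, CMP 400 (2023) 805–851 = arXiv:2204.12737v1: Theorem 1.2 with (1.4),
  (1.6), (1.7) p. 5; (2.3); (3.6); Theorem 4.2 with (4.5)–(4.8) p. 18–19; Remark 4.6 p. 20; §5:
  Lemma 5.1, (5.3), (5.13), proof of Theorem 1.2 with (5.15) [ShenZhuZhuCMP2023].
* S. Gallot, D. Hulin, J. Lafontaine, *Riemannian Geometry*, 3rd ed. (2004): 2.90, 2.103, 2.108 (c)
  [GallotHulinLafontaine2004].
-/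

noncomputable section

open MeasureTheory ProbabilityTheory Filter Topology
open scoped NNReal ENNReal Matrix
open Literature.MathematicalPhysics.QuantumLattice
open Literature.Probability.LatticeModels (zdGraph)
open Literature.MathematicalPhysics.QuantumFieldTheory.Balaban1983to89.TraceWordsSeparateOrbitsOrthogonal
  (specialOrthogonalRep specialOrthogonalRep_apply continuous_specialOrthogonalRep
    specialOrthogonalRep_injective)

namespace Literature.MathematicalPhysics.QuantumFieldTheory

/-! ### The two structure groups: scope predicates and the `SO(N)` lattice representation -/

namespace LatticeRep

variable {G : Type*} [Group G] [TopologicalSpace G] (r : LatticeRep G)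

/-- `ρ(G) = SO(N)` (real orthogonal matrices of determinant one, read in `M_N(ℂ)`): the first of
SZZ's two structure groups ("We write `G` for the Lie group `SO(N)` or `SU(N)`", §1.1); the first
disjunct of `LatticeRep.IsClassicalDefining`. [cite: ShenZhuZhuCMP2023, §1.1] -/
def IsDefiningSO : Prop :=
  Set.range r.ρ = Complex.ofRealHom.mapMatrix ''
    (Matrix.specialOrthogonalGroup (Fin r.N) ℝ : Set (Matrix (Fin r.N) (Fin r.N) ℝ))

/-- `ρ(G) = SU(N)`: the second of SZZ's structure groups; the second disjunct of
`LatticeRep.IsClassicalDefining`. [cite: ShenZhuZhuCMP2023, §1.1] -/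
def IsDefiningSU : Prop :=
  Set.range r.ρ = (Matrix.specialUnitaryGroup (Fin r.N) ℂ : Set (Matrix (Fin r.N) (Fin r.N) ℂ))

/-- The printed scope `IsClassicalDefining` is the disjunction of the two cases. [cite: ShenZhuZhuCMP2023, §1.1] -/
theorem isClassicalDefining_iff : r.IsClassicalDefining ↔ r.IsDefiningSO ∨ r.IsDefiningSU := Iff.rfl

end LatticeRep

/-- For `Q ∈ SO(N)` the complexified matrix is unitary (`Q Qᵀ = 1` read in `ℂ`; SZZ §2: "Every matrix
`Q` in one of these Lie groups satisfies `QQ^* = I_N`"). [cite: ShenZhuZhuCMP2023, §2 (Lie groups and algebras)] -/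
theorem specialOrthogonalRep_mem_unitaryGroup {N : ℕ} (Q : Matrix.specialOrthogonalGroup (Fin N) ℝ) :
    specialOrthogonalRep (Fin N) Q ∈ Matrix.unitaryGroup (Fin N) ℂ := by
  rw [Matrix.mem_unitaryGroup_iff, specialOrthogonalRep_apply]
  have hQ : (Q : Matrix (Fin N) (Fin N) ℝ) * (Q : Matrix (Fin N) (Fin N) ℝ)ᵀ = 1 := by
    have h := Matrix.mem_unitaryGroup_iff.1 (Matrix.mem_specialOrthogonalGroup_iff.1 Q.2).1
    simpa [Matrix.star_eq_conjTranspose, Matrix.conjTranspose_eq_transpose_of_trivial] using h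
  have hstar : star ((Q : Matrix (Fin N) (Fin N) ℝ).map Complex.ofReal) =
      ((Q : Matrix (Fin N) (Fin N) ℝ)ᵀ).map Complex.ofReal := by
    ext i j
    simp
  have hmul : ((Q : Matrix (Fin N) (Fin N) ℝ).map Complex.ofReal) *
      ((Q : Matrix (Fin N) (Fin N) ℝ)ᵀ).map Complex.ofReal =
      ((Q : Matrix (Fin N) (Fin N) ℝ) * (Q : Matrix (Fin N) (Fin N) ℝ)ᵀ).map Complex.ofReal :=
    (Matrix.map_mul (f := Complex.ofRealHom)).symm
  rw [hstar, hmul, hQ, Matrix.map_one _ Complex.ofReal_zero Complex.ofReal_one]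

/-- **`SO(N)` lattice Yang–Mills data**: the compact group `SO(N)` with its defining representation
read in `M_N(ℂ)` (`specialOrthogonalRep`), continuous, faithful and unitary — SZZ's structure group
`G = SO(N)`. [cite: ShenZhuZhuCMP2023, §1.1] -/
def soLatticeRep (N : ℕ) : LatticeRep (Matrix.specialOrthogonalGroup (Fin N) ℝ) :=
  ⟨N, specialOrthogonalRep (Fin N), continuous_specialOrthogonalRep _, specialOrthogonalRep_injective _,
    specialOrthogonalRep_mem_unitaryGroup⟩

/-- The degree of `soLatticeRep N` is `N` (`SO(N) ⊆ M_N`). [cite: ShenZhuZhuCMP2023, §1.1] -/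
@[simp] theorem soLatticeRep_N (N : ℕ) : (soLatticeRep N).N = N := rfl

/-- `soLatticeRep N` is in the `SO(N)` scope. [cite: ShenZhuZhuCMP2023, §1.1] -/
theorem isDefiningSO_soLatticeRep (N : ℕ) : (soLatticeRep N).IsDefiningSO := by
  change Set.range (specialOrthogonalRep (Fin N)) = Complex.ofRealHom.mapMatrix ''
    (Matrix.specialOrthogonalGroup (Fin N) ℝ : Set (Matrix (Fin N) (Fin N) ℝ))
  ext A
  constructor
  · rintro ⟨Q, rfl⟩
    exact ⟨(Q : Matrix (Fin N) (Fin N) ℝ), Q.2, rfl⟩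
  · rintro ⟨B, hB, rfl⟩
    exact ⟨⟨B, hB⟩, rfl⟩

/-- `SU(N)` in its fundamental representation (`fundamentalLatticeRep N`) is in the `SU(N)` scope.
[cite: ShenZhuZhuCMP2023, §1.1] -/
theorem isDefiningSU_fundamentalLatticeRep (N : ℕ) : (fundamentalLatticeRep N).IsDefiningSU :=
  Subtype.range_coe

/-! ### The constants: `C_{Ric,N}`, `K_𝒮`, and the ergodic rate `K̃_𝒮` of (5.15) -/

section Constants

variable {N d : ℕ} {β : ℝ}

/-- `C_{Ric,N} = (N+2)/4 - 1` for `SO(N)`: the Ricci curvature of the Hilbert–Schmidt bi-invariant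
metric, `Ric(u,u) = (α(N+2)/4 - 1)|u|²` with `α = 1` ((4.8), after [AGZ10]). [cite: ShenZhuZhuCMP2023, (4.8)] -/
def szzRicciConstSO (N : ℕ) : ℝ := ((N : ℝ) + 2) / 4 - 1

/-- `C_{Ric,N} = (N+2)/2 - 1 (= N/2)` for `SU(N)` ((4.8) with `α = 2`). [cite: ShenZhuZhuCMP2023, (4.8)] -/
def szzRicciConstSU (N : ℕ) : ℝ := ((N : ℝ) + 2) / 2 - 1

/-- `C_{Ric,N}(SU(N)) = N/2`. [cite: ShenZhuZhuCMP2023, (4.8)] -/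
theorem szzRicciConstSU_eq_half (N : ℕ) : szzRicciConstSU N = N / 2 := by
  unfold szzRicciConstSU; ring

/-- `K_𝒮 = C_{Ric,N} - 8N|β|(d-1)` (`SO(N)`). [cite: ShenZhuZhuCMP2023, Assumption 1.1] -/
theorem szzBakryEmeryConstSO_eq_ricci (N d : ℕ) (β : ℝ) :
    szzBakryEmeryConstSO N d β = szzRicciConstSO N - 8 * N * |β| * ((d : ℝ) - 1) := rfl

/-- `K_𝒮 = C_{Ric,N} - 8N|β|(d-1)` (`SU(N)`). [cite: ShenZhuZhuCMP2023, Assumption 1.1] -/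
theorem szzBakryEmeryConstSU_eq_ricci (N d : ℕ) (β : ℝ) :
    szzBakryEmeryConstSU N d β = szzRicciConstSU N - 8 * N * |β| * ((d : ℝ) - 1) := rfl

/-- **The ergodic rate `K̃_𝒮 = C_{Ric,N} - (4+4√a)N|β|(d-1)`** of Lemma 5.1 / Theorem 1.2 (3), (5.15),
for `SO(N)` and weight parameter `a` (the exponential `W_2^{ρ_{∞,a}}`-contraction rate, a lower bound
for the spectral gap of `(P_t)` in Wasserstein distance — remark after Theorem 1.2).
[cite: ShenZhuZhuCMP2023, Lemma 5.1] -/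
def szzErgodicRateSO (a : ℝ) (N d : ℕ) (β : ℝ) : ℝ :=
  szzRicciConstSO N - (4 + 4 * Real.sqrt a) * N * |β| * ((d : ℝ) - 1)

/-- **The ergodic rate `K̃_𝒮`** of (5.15) for `SU(N)`. [cite: ShenZhuZhuCMP2023, Lemma 5.1] -/
def szzErgodicRateSU (a : ℝ) (N d : ℕ) (β : ℝ) : ℝ :=
  szzRicciConstSU N - (4 + 4 * Real.sqrt a) * N * |β| * ((d : ℝ) - 1)

/-- At `a = 1` the ergodic rate is the Bakry–Émery constant: `K̃_𝒮(1) = K_𝒮` (`SO(N)`). [cite: ShenZhuZhuCMP2023, Lemma 5.1] -/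
theorem szzErgodicRateSO_one (N d : ℕ) (β : ℝ) : szzErgodicRateSO 1 N d β = szzBakryEmeryConstSO N d β := by
  unfold szzErgodicRateSO szzBakryEmeryConstSO szzRicciConstSO; rw [Real.sqrt_one]; ring

/-- `K̃_𝒮(1) = K_𝒮` (`SU(N)`). [cite: ShenZhuZhuCMP2023, Lemma 5.1] -/
theorem szzErgodicRateSU_one (N d : ℕ) (β : ℝ) : szzErgodicRateSU 1 N d β = szzBakryEmeryConstSU N d β := by
  unfold szzErgodicRateSU szzBakryEmeryConstSU szzRicciConstSU; rw [Real.sqrt_one]; ring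

/-- `K̃_𝒮 ≤ K_𝒮` for `a ≥ 1`, `d ≥ 1` (`SU(N)`): the weighted rate never exceeds the Bakry–Émery one.
[cite: ShenZhuZhuCMP2023, Lemma 5.1] -/
theorem szzErgodicRateSU_le (hd : 1 ≤ d) {a : ℝ} (ha : 1 ≤ a) (N : ℕ) (β : ℝ) :
    szzErgodicRateSU a N d β ≤ szzBakryEmeryConstSU N d β := by
  rw [← szzErgodicRateSU_one]
  unfold szzErgodicRateSU
  have hd' : (0 : ℝ) ≤ (d : ℝ) - 1 := by
    have : (1 : ℝ) ≤ d := by exact_mod_cast hd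
    linarith
  have hs : Real.sqrt 1 ≤ Real.sqrt a := Real.sqrt_le_sqrt ha
  have hM : 0 ≤ (N : ℝ) * |β| * ((d : ℝ) - 1) := by positivity
  nlinarith

/-- Same for `SO(N)`. [cite: ShenZhuZhuCMP2023, Lemma 5.1] -/
theorem szzErgodicRateSO_le (hd : 1 ≤ d) {a : ℝ} (ha : 1 ≤ a) (N : ℕ) (β : ℝ) :
    szzErgodicRateSO a N d β ≤ szzBakryEmeryConstSO N d β := by
  rw [← szzErgodicRateSO_one]
  unfold szzErgodicRateSO
  have hd' : (0 : ℝ) ≤ (d : ℝ) - 1 := by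
    have : (1 : ℝ) ≤ d := by exact_mod_cast hd
    linarith
  have hs : Real.sqrt 1 ≤ Real.sqrt a := Real.sqrt_le_sqrt ha
  have hM : 0 ≤ (N : ℝ) * |β| * ((d : ℝ) - 1) := by positivity
  nlinarith

/-- A continuous real function positive at `1` is positive at some `a > 1`. [folklore] -/
private theorem exists_gt_one_of_pos_one {f : ℝ → ℝ} (hf : Continuous f) (h : 0 < f 1) :
    ∃ a : ℝ, 1 < a ∧ 0 < f a := by
  have h1 : ∀ᶠ a in 𝓝 (1 : ℝ), 0 < f a := hf.continuousAt.eventually (lt_mem_nhds h)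
  have h2 : ∀ᶠ a in 𝓝[>] (1 : ℝ), 1 < a := eventually_nhdsWithin_of_forall fun a ha => ha
  exact (h2.and (h1.filter_mono nhdsWithin_le_nhds)).exists

/-- **SZZ, proof of Theorem 1.2: "by the condition `K_𝒮 > 0`, there exists `a > 1` such that
`K̃_𝒮 = C_{Ric,N} - (4+4√a)N|β|(d-1) > 0`" ((5.15))**, `SU(N)` — proved (continuity of `a ↦ K̃_𝒮(a)` at
`a = 1`, where it equals `K_𝒮`). [cite: ShenZhuZhuCMP2023, (5.15)] -/
theorem exists_szzErgodicRateSU_pos (h : 0 < szzBakryEmeryConstSU N d β) :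
    ∃ a : ℝ, 1 < a ∧ 0 < szzErgodicRateSU a N d β :=
  exists_gt_one_of_pos_one (by unfold szzErgodicRateSU; fun_prop) (by rwa [szzErgodicRateSU_one])

/-- Same for `SO(N)`. [cite: ShenZhuZhuCMP2023, (5.15)] -/
theorem exists_szzErgodicRateSO_pos (h : 0 < szzBakryEmeryConstSO N d β) :
    ∃ a : ℝ, 1 < a ∧ 0 < szzErgodicRateSO a N d β :=
  exists_gt_one_of_pos_one (by unfold szzErgodicRateSO; fun_prop) (by rwa [szzErgodicRateSO_one])

end Constants

/-! ### The distances `ρ`, `ρ_L`, `ρ_{∞,a}` and the squared `W_2` transport cost -/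

namespace LatticeRep

variable {G : Type*} [Group G] [TopologicalSpace G] (r : LatticeRep G)

/-- **The Riemannian distance `ρ` on `G`** for the bi-invariant metric induced by the
Hilbert–Schmidt inner product `⟨X,Y⟩ = Re Tr(XY^*)` on `𝔤 ⊆ M_N(ℂ)` (SZZ §2, (2.3); "We denote the
Riemannian distance on `G` by `ρ`", §4.1): the geodesics through `Q` are the curves `t ↦ e^{tX}Q`,
`X ∈ 𝔤` (Gallot–Hulin–Lafontaine 2.90 (c)), every point of the compact connected group is reached
by a minimising one (2.103, 2.108 (c)), so `ρ(Q,Q') = inf{|X| : X ∈ 𝔤, e^X Q = Q'}`, `|X|² = ⟨X,X⟩`.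
Rendered through `ρ = r.ρ`, `𝔤 = r.lieAlg`; junk value `0` if no `X` exists (never the case for
`SO(N)`, `SU(N)`). [cite: GallotHulinLafontaine2004, 2.90 and 2.108 (c)] -/
def riemannDist (g h : G) : ℝ :=
  sInf ((fun X => Real.sqrt (hsForm r.N X X)) ''
    {X | X ∈ r.lieAlg ∧ NormedSpace.exp X * r.ρ g = r.ρ h})

/-- `ρ ≥ 0` (the Riemannian distance is a distance, GHL 2.91). [cite: GallotHulinLafontaine2004, 2.91] -/
theorem riemannDist_nonneg (g h : G) : 0 ≤ r.riemannDist g h :=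
  Real.sInf_nonneg (by rintro _ ⟨X, -, rfl⟩; exact Real.sqrt_nonneg _)

/-- `ρ(g,g) = 0` (witness `X = 0`, `e^0 = 1`; GHL 2.91: `d` is a distance). [cite: GallotHulinLafontaine2004, 2.91] -/
theorem riemannDist_self (g : G) : r.riemannDist g g = 0 := by
  refine le_antisymm ?_ (r.riemannDist_nonneg g g)
  refine csInf_le ⟨0, ?_⟩ ⟨0, ⟨r.lieAlg.zero_mem, by simp⟩, by simp⟩
  rintro _ ⟨X, -, rfl⟩; exact Real.sqrt_nonneg _

end LatticeRep

section Distances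

variable {G : Type*} [Group G] [TopologicalSpace G] (r : LatticeRep G) {d L : ℕ}

/-- **`ρ_L(Q,Q')² = Σ_{e ∈ E⁺_{Λ_L}} ρ(Q_e,Q'_e)²`**, the squared Riemannian distance of the product
metric on `𝒬_L = G^{E⁺_{Λ_L}}` (§4.1, before Theorem 4.2). [cite: ShenZhuZhuCMP2023, Theorem 4.2] -/
def torusRiemannDistSq [NeZero L] (U U' : GaugeConfig d L G) : ℝ :=
  ∑ e : Edge d L, r.riemannDist (U e) (U' e) ^ 2

/-- `|e|` for a positively oriented edge `e = (x, i)` of `ℤ^d`: "the distance from `0` to `e` in `ℤ^d`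
… more precisely the minimum of the distances from the two vertices of `e` to `0`" ((1.4), (3.6)),
read as graph distance in the nearest-neighbour graph `zdGraph d` (flag (d) of the module docstring).
[cite: ShenZhuZhuCMP2023, (3.6)] -/
def edgeLevel (e : ZdEdge d) : ℕ :=
  min ((zdGraph d).dist 0 e.1) ((zdGraph d).dist 0 (e.1 + Pi.single e.2 1))

/-- **`ρ_{∞,a}(Q,Q')² = Σ_{e ∈ E⁺} a^{-|e|} ρ(Q_e,Q'_e)²`** ((1.4)) on configurations of `ℤ^d`
(`a > 1`; the series converges since `ρ` is bounded on the compact `G` and `#{e : |e| = n}` grows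
polynomially — `tsum`, junk `0` otherwise). [cite: ShenZhuZhuCMP2023, (1.4)] -/
def weightedRiemannDistSq (a : ℝ) (V V' : LGConfig d G) : ℝ :=
  ∑' e : ZdEdge d, (a ^ edgeLevel e)⁻¹ * r.riemannDist (V e) (V' e) ^ 2

/-- `ρ_L(Q,Q)² = 0` (`ρ_L` is the Riemannian distance of the product metric). [cite: ShenZhuZhuCMP2023, Theorem 4.2] -/
theorem torusRiemannDistSq_self [NeZero L] (U : GaugeConfig d L G) : torusRiemannDistSq r U U = 0 := by
  simp [torusRiemannDistSq, LatticeRep.riemannDist_self]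

/-- **`W_2^c(μ,ν)² := inf_{π ∈ 𝒞(μ,ν)} ∫ c dπ`**, the squared Wasserstein distance for a squared cost
`c = ρ²` ("`W_2^{ρ_{∞,a}}(μ,ν) := inf_{π∈𝒞(μ,ν)} π(ρ²_{∞,a})^{1/2}` with `𝒞(μ,ν)` the set of couplings",
§1.2 after (1.7); `W_p^{ρ_L}`, §4.1), valued in `[0,∞]` (`∞` iff there is no coupling); couplings are
the tree's `Literature.Geometry.Riemannian.IsCoupling`. [cite: ShenZhuZhuCMP2023, Theorem 1.2] -/
def szzWassersteinSq {X : Type*} [MeasurableSpace X] (c : X → X → ℝ) (μ ν : Measure X) : ℝ≥0∞ :=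
  ⨅ q : {q : Measure (X × X) // Literature.Geometry.Riemannian.IsCoupling μ ν q},
    ∫⁻ z, ENNReal.ofReal (c z.1 z.2) ∂(q : Measure (X × X))

/-- Every coupling bounds `W_2²` (it is an infimum over couplings). [cite: ShenZhuZhuCMP2023, Theorem 1.2] -/
theorem szzWassersteinSq_le {X : Type*} [MeasurableSpace X] (c : X → X → ℝ) {μ ν : Measure X}
    {q : Measure (X × X)} (hq : Literature.Geometry.Riemannian.IsCoupling μ ν q) :
    szzWassersteinSq c μ ν ≤ ∫⁻ z, ENNReal.ofReal (c z.1 z.2) ∂q :=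
  iInf_le (fun q : {q : Measure (X × X) // Literature.Geometry.Riemannian.IsCoupling μ ν q} =>
    ∫⁻ z, ENNReal.ofReal (c z.1 z.2) ∂(q : Measure (X × X))) ⟨q, hq⟩

end Distances

/-! ### Conclusion shapes (finite volume `Λ_L`, tree coupling `β'`, rate `K`) -/

section Shapes

variable {G : Type*} [Group G] [TopologicalSpace G] [MeasurableSpace G] (r : LatticeRep G)
  (d L : ℕ) [NeZero L] (β' K : ℝ)

/-- **`W_2`-contraction from Dirac initial data** with squared cost `c` and rate `K` for the dynamics
`latticeLangevinDynamics r β'` on `Λ_L`: for any two strong solutions `U`, `U'` started at `Q`, `Q̄`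
(each on its own probability space, adapted to the natural filtration of its driving flat Brownian
motion), `W_2^c(Law U_t, Law U'_t)² ≤ e^{-2Kt} c(Q,Q̄)` for all `t ≥ 0` — the shape of (4.5)
(`c = ρ_L²`, `K = K_𝒮`) and of Lemma 5.1 / (5.3) (`c = ρ²_{∞,a}`, `K = K̃_𝒮`). [cite: ShenZhuZhuCMP2023, (4.5)] -/
def SZZDiracContraction (c : GaugeConfig d L G → GaugeConfig d L G → ℝ) : Prop :=
  ∀ (Ω : Type) [MeasurableSpace Ω] (P : Measure Ω) [IsProbabilityMeasure P]
    (W : ℝ≥0 → Ω → (Edge d L × NoiseIdx r.N → ℝ)) (hW : IsFlatBrownian W P)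
    (U : ℝ≥0 → Ω → GaugeConfig d L G) (Q : GaugeConfig d L G),
    (∀ ω, U 0 ω = Q) → (latticeLangevinDynamics r β').IsSolution r.ρ hW.natFiltration P W U →
  ∀ (Ω' : Type) [MeasurableSpace Ω'] (P' : Measure Ω') [IsProbabilityMeasure P']
    (W' : ℝ≥0 → Ω' → (Edge d L × NoiseIdx r.N → ℝ)) (hW' : IsFlatBrownian W' P')
    (U' : ℝ≥0 → Ω' → GaugeConfig d L G) (Q' : GaugeConfig d L G),
    (∀ ω, U' 0 ω = Q') → (latticeLangevinDynamics r β').IsSolution r.ρ hW'.natFiltration P' W' U' →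
  ∀ t : ℝ≥0, szzWassersteinSq c (P.map (U t)) (P'.map (U' t)) ≤
    ENNReal.ofReal (Real.exp (-2 * K * t) * c Q Q')

/-- **Uniqueness of the invariant measure of `(P_t^L)`** (Theorem 4.2, "In particular, invariant
measure of `(P_t^L)_{t≥0}` is unique"): for every family `(U^x)_x` of strong solutions started at the
points `x ∈ G^{E⁺_{Λ_L}}`, any two probability measures invariant under the transition operators
`P_t f(x) = 𝔼 f(U^x_t)` (tested on bounded measurable `f`) coincide. [cite: ShenZhuZhuCMP2023, Theorem 4.2] -/
def SZZUniqueInvariantMeasure : Prop :=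
  ∀ (Ω : Type) [MeasurableSpace Ω] (P : Measure Ω) [IsProbabilityMeasure P]
    (W : ℝ≥0 → Ω → (Edge d L × NoiseIdx r.N → ℝ)) (hW : IsFlatBrownian W P)
    (U : GaugeConfig d L G → ℝ≥0 → Ω → GaugeConfig d L G),
    (∀ x, (∀ ω, U x 0 ω = x) ∧ (latticeLangevinDynamics r β').IsSolution r.ρ hW.natFiltration P W (U x)) →
    ∀ (μ ν : Measure (GaugeConfig d L G)), IsProbabilityMeasure μ → IsProbabilityMeasure ν →
      (∀ f : GaugeConfig d L G → ℝ, Measurable f → (∃ C : ℝ, ∀ y, |f y| ≤ C) → ∀ t : ℝ≥0,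
        ∫ x, markovTransition U P t f x ∂μ = ∫ x, f x ∂μ) →
      (∀ f : GaugeConfig d L G → ℝ, Measurable f → (∃ C : ℝ, ∀ y, |f y| ≤ C) → ∀ t : ℝ≥0,
        ∫ x, markovTransition U P t f x ∂ν = ∫ x, f x ∂ν) →
      μ = ν

variable [IsTopologicalGroup G] [CompactSpace G] [BorelSpace G]

/-- **`L²` spectral gap of `(P_t^L)`** (Remark 4.6: "`‖P_t^L f - μ_{Λ_L,N,β}(f)‖_{L²(μ_{Λ_L,N,β})} ≤
e^{-tK_𝒮}‖f‖_{L²(μ_{Λ_L,N,β})}`"), squared, for bounded measurable `f`, with `μ = wilsonMeasure r.ρ β'`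
and `P_t f(x) = 𝔼 f(U^x_t)` for a family of strong solutions `(U^x)_x`. [cite: ShenZhuZhuCMP2023, Remark 4.6] -/
def SZZL2SpectralGap : Prop :=
  ∀ (Ω : Type) [MeasurableSpace Ω] (P : Measure Ω) [IsProbabilityMeasure P]
    (W : ℝ≥0 → Ω → (Edge d L × NoiseIdx r.N → ℝ)) (hW : IsFlatBrownian W P)
    (U : GaugeConfig d L G → ℝ≥0 → Ω → GaugeConfig d L G),
    (∀ x, (∀ ω, U x 0 ω = x) ∧ (latticeLangevinDynamics r β').IsSolution r.ρ hW.natFiltration P W (U x)) →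
    ∀ f : GaugeConfig d L G → ℝ, Measurable f → (∃ C : ℝ, ∀ y, |f y| ≤ C) → ∀ t : ℝ≥0,
      ∫ x, (markovTransition U P t f x - ∫ y, f y ∂(wilsonMeasure (d := d) (L := L) r.ρ β')) ^ 2
          ∂(wilsonMeasure (d := d) (L := L) r.ρ β') ≤
        Real.exp (-2 * K * t) * ∫ x, f x ^ 2 ∂(wilsonMeasure (d := d) (L := L) r.ρ β')

end Shapes

/-! ### The named facts -/

section Facts

variable {G : Type*} [Group G] [TopologicalSpace G] [IsTopologicalGroup G] [CompactSpace G]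
  [MeasurableSpace G] [BorelSpace G]

/-- **Shen–Zhu–Zhu, Theorem 4.2 (1) and its "in particular"** (arXiv:2204.12737v1 p. 18–19; proof:
the Bakry–Émery condition (4.7) `Ric - Hess_𝒮 ≥ K_𝒮` from Lemma 4.1 and (4.8), then [Wan06]).
"Under Assumption 1.1, the following hold. • The dynamic defined by the SDE (3.3) is exponentially
ergodic in the sense that `W_2^{ρ_L}(δ_Q P_t^L, δ_{Q̄} P_t^L) ≤ e^{-K_𝒮 t} ρ_L(Q,Q̄)`, `t ≥ 0`,
`Q, Q̄ ∈ 𝒬_L` (4.5). • [(4.6), not typed]. In particular, invariant measure of `(P_t^L)_{t≥0}` is unique."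
Rendered for the tree's dynamics `latticeLangevinDynamics r (Nβ)` on every torus `Λ_L`, `L > 1`,
`d ≥ 2`, in the two printed cases: `ρ(G) = SU(N)` with `K_𝒮 = szzBakryEmeryConstSU N d β > 0`, and
`ρ(G) = SO(N)` with `K_𝒮 = szzBakryEmeryConstSO N d β > 0` (`N = r.N`); see the module docstring,
flags (a), (b), (e). [cite: ShenZhuZhuCMP2023, Theorem 4.2] -/
def shenZhuZhu_finiteVolumeErgodicity (r : LatticeRep G) (d : ℕ) : Prop :=
  2 ≤ d →
    (r.IsDefiningSU → ∀ β : ℝ, 0 < szzBakryEmeryConstSU r.N d β → ∀ (L : ℕ) [NeZero L], 1 < L →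
      SZZDiracContraction r d L (r.N * β) (szzBakryEmeryConstSU r.N d β) (torusRiemannDistSq r) ∧
      SZZUniqueInvariantMeasure r d L (r.N * β)) ∧
    (r.IsDefiningSO → ∀ β : ℝ, 0 < szzBakryEmeryConstSO r.N d β → ∀ (L : ℕ) [NeZero L], 1 < L →
      SZZDiracContraction r d L (r.N * β) (szzBakryEmeryConstSO r.N d β) (torusRiemannDistSq r) ∧
      SZZUniqueInvariantMeasure r d L (r.N * β))

/-- **Shen–Zhu–Zhu, Remark 4.6** (arXiv:2204.12737v1 p. 20): "By the Poincaré inequality (4.11)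
and (4.13), the semigroup `(P_t^L)_{t≥0}` … satisf[ies]
`‖P_t^L f - μ_{Λ_L,N,β}(f)‖_{L²(μ_{Λ_L,N,β})} ≤ e^{-tK_𝒮}‖f‖_{L²(μ_{Λ_L,N,β})}` (c.f. [Wan06])", under
Assumption 1.1. Rendered (squared, bounded measurable `f`, flag (f)) for `latticeLangevinDynamics r (Nβ)`
and `μ_{Λ_L,N,β} = wilsonMeasure r.ρ (Nβ)`, `L > 1`, `d ≥ 2`, cases `SU(N)` / `SO(N)` with their
`K_𝒮`. [cite: ShenZhuZhuCMP2023, Remark 4.6] -/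
def shenZhuZhu_L2SpectralGap (r : LatticeRep G) (d : ℕ) : Prop :=
  2 ≤ d →
    (r.IsDefiningSU → ∀ β : ℝ, 0 < szzBakryEmeryConstSU r.N d β → ∀ (L : ℕ) [NeZero L], 1 < L →
      SZZL2SpectralGap r d L (r.N * β) (szzBakryEmeryConstSU r.N d β)) ∧
    (r.IsDefiningSO → ∀ β : ℝ, 0 < szzBakryEmeryConstSO r.N d β → ∀ (L : ℕ) [NeZero L], 1 < L →
      SZZL2SpectralGap r d L (r.N * β) (szzBakryEmeryConstSO r.N d β))

/-- **Shen–Zhu–Zhu, Lemma 5.1** (arXiv:2204.12737v1 p. 31; the coupling estimate behind Theorem 1.2,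
uniform in the volume). "Suppose that `K̃_𝒮 := C_{Ric,N} - (4+4√a)N|β|(d-1) > 0`. Then for every
`L ∈ ℤ`, `W_2^{ρ_{∞,a}}(μP_t^L, νP_t^L) ≤ e^{-K̃_𝒮 t} W_2^{ρ_{∞,a}}(μ,ν)`, `t ≥ 0`, `μ, ν ∈ 𝒫(𝒬_L)`. Here we
use periodic extension to view every measure as a probability on `𝒬`." ("In the following we prove
the result for any `a > 1`"; proof: Kendall–Cranston-type coupling (5.4) and
`Σ_e a^{-|e|} ∂_t ρ_e² ≤ -2C_{Ric,N} Σ_e a^{-|e|}ρ_e² + (8+8√a)N|β|(d-1) Σ_e a^{-|e|}ρ_e²` (5.13), Gronwall.)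
Rendered in the Dirac form `μ = δ_Q`, `ν = δ_{Q̄}` (flag (a)): the laws at time `t` of two strong
solutions of `latticeLangevinDynamics r (Nβ)` from `Q`, `Q̄` have squared `W_2` cost for
`ρ²_{∞,a} ∘ torusLift` at most `e^{-2K̃_𝒮 t} ρ_{∞,a}(Q,Q̄)²`, for every `a > 1` with `K̃_𝒮 > 0`, every
`L > 1`, `d ≥ 2`; cases `SU(N)` / `SO(N)` with `K̃_𝒮 = szzErgodicRateSU/SO a N d β`. [cite: ShenZhuZhuCMP2023, Lemma 5.1] -/
def shenZhuZhu_weightedContraction (r : LatticeRep G) (d : ℕ) : Prop :=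
  2 ≤ d → ∀ a : ℝ, 1 < a →
    (r.IsDefiningSU → ∀ β : ℝ, 0 < szzErgodicRateSU a r.N d β → ∀ (L : ℕ) [NeZero L], 1 < L →
      SZZDiracContraction r d L (r.N * β) (szzErgodicRateSU a r.N d β)
        (fun U U' => weightedRiemannDistSq r a (torusLift L U) (torusLift L U'))) ∧
    (r.IsDefiningSO → ∀ β : ℝ, 0 < szzErgodicRateSO a r.N d β → ∀ (L : ℕ) [NeZero L], 1 < L →
      SZZDiracContraction r d L (r.N * β) (szzErgodicRateSO a r.N d β)
        (fun U U' => weightedRiemannDistSq r a (torusLift L U) (torusLift L U')))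

end Facts

end Literature.MathematicalPhysics.QuantumFieldTheory
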